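import Summits.ResolutionOfSingularities.ResolutionOfSingularities.Theorems.HugValuationCutKernels
import Summits.ResolutionOfSingularities.ResolutionOfSingularities.Theorems.MaxContactCutSurfaceShadow
import Summits.ResolutionOfSingularities.ResolutionOfSingularities.Theorems.CornerTowerDynamics
import HarnessLib

/-!
# MaxContactCutHugValuationCut — the decomp-res node «HugValuationCut» BY NAME on the host route `MaxContactCut`
(lens-4 g14, sha256 52ca7cd9298143bb; critic row 91 CLEARED)

Tree file 4/4: §6 — THE TARGET 32260 `MaxContactCut.NoSingularSurfaceHuggingTowers` BY NAME from the two g14 residuals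
`NoDenseShadowTowers` (Z) / `NoDiscreteImperfectShadowTowers` (D-imp) and the ports (`noSingularSurfaceHuggingTowers_of_g14`,
the EXACT `noSingularSurfaceHuggingTowers_iff_residuals`); necessity port-free; and up the tree to 31570 / 30253
through the landed
`MaxContactCutSurfaceShadow` kernels, the primed variants with leaf #17′ `NoCornerTowers` DISCHARGED by
`CornerTowerDynamics.noCornerTowers_tree` — VERBATIM.
(Sources: CossartJannsenSaito2020; ZariskiSamuelII.)
-/

noncomputable section

open CategoryTheory AlgebraicGeometry IsLocalRing
open Literature.AlgebraicGeometry.Resolution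
open Summit.ResolutionOfSingularities.ResolutionOfSingularities.Theses
open Summit.ResolutionOfSingularities.ResolutionOfSingularities.Theorems
open WeakOrderReduction ForcedTowerClasses DivergentTowerClasses MonomialTowerClasses
open HugDimensionClasses HugDimensionKernels SurfaceShadowClasses SurfaceShadowKernels
open ContactShadowClasses (NoTowerImperfect)
open NearPointCut (SingularClass)

namespace Summit.ResolutionOfSingularities.ResolutionOfSingularities.Theorems.HugValuationCut

/-- **THE TARGET 32260 `MaxContactCut.NoSingularSurfaceHuggingTowers` BY NAME from the two g14 residuals, the port
and the engine.** [folklore] -/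
theorem noSingularSurfaceHuggingTowers_of_g14 (hP : ShadowPortAll) (hL : DiscreteShadowLawAll)
    (hI : NoDiscreteImperfectShadowTowers) (hZ : NoDenseShadowTowers) :
    MaxContactCut.NoSingularSurfaceHuggingTowers :=
  fun n hn => singularSurface_of_g14 (hP n hn) (hL n hn) (hI n hn) (hZ n hn)

/-- Necessity, port-free: 32260 implies the residual (Z). [folklore] -/
theorem noDenseShadowTowers_of_item (h : MaxContactCut.NoSingularSurfaceHuggingTowers) : NoDenseShadowTowers :=
  fun n hn => (pieces_of_singularSurface (h n hn)).2.2.2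

/-- Necessity, port-free: 32260 implies the residual (D-imp). [folklore] -/
theorem noDiscreteImperfectShadowTowers_of_item (h : MaxContactCut.NoSingularSurfaceHuggingTowers) :
    NoDiscreteImperfectShadowTowers :=
  fun n hn => (pieces_of_singularSurface (h n hn)).2.2.1

/-- **EXACT at the item, modulo the port and the engine**: 32260 ⟺ (D-imp) ∧ (Z). [folklore] -/
theorem noSingularSurfaceHuggingTowers_iff_residuals (hP : ShadowPortAll) (hL : DiscreteShadowLawAll) :
    MaxContactCut.NoSingularSurfaceHuggingTowers ↔ NoDiscreteImperfectShadowTowers ∧ NoDenseShadowTowers :=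
  ⟨fun h => ⟨noDiscreteImperfectShadowTowers_of_item h, noDenseShadowTowers_of_item h⟩,
    fun h => noSingularSurfaceHuggingTowers_of_g14 hP hL h.1 h.2⟩

/-- **32203 `MaxContactCut.NoSurfaceHuggingTowers` BY NAME** (tree kernel `surfaceLeaf_of_surfaceLaw` + g14).
[folklore] -/
theorem noSurfaceHuggingTowers_of_g14 (hSL : MaxContactCut.SurfaceLawAll) (hP : ShadowPortAll)
    (hL : DiscreteShadowLawAll) (hI : NoDiscreteImperfectShadowTowers) (hZ : NoDenseShadowTowers) :
    MaxContactCut.NoSurfaceHuggingTowers :=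
  fun n hn => surfaceLeaf_of_surfaceLaw (hSL n hn) (noSingularSurfaceHuggingTowers_of_g14 hP hL hI hZ n hn)

/-- **31570 `MaxContactCut.NoHuggingTowers` BY NAME** (tree kernel `MaxContactCutSurfaceShadow.noHuggingTowers_of_g11`,
its singular-surface hypothesis discharged by g14; `NoCornerTowers` is lens-3's `noCornerTowers_tree`, pending filing).
[folklore] -/
theorem noHuggingTowers_of_g14 (hM : MaxContactCut.MonomialCornerAll) (hK : NoCornerTowers)
    (hC : MaxContactCut.CurveLawAll) (hSL : MaxContactCut.SurfaceLawAll)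
    (hH : MaxContactCut.NoHypersurfaceHuggingTowers) (hP : ShadowPortAll) (hL : DiscreteShadowLawAll)
    (hI : NoDiscreteImperfectShadowTowers) (hZ : NoDenseShadowTowers) :
    MaxContactCut.NoHuggingTowers :=
  MaxContactCutSurfaceShadow.noHuggingTowers_of_g11 hM hK hC hSL
    (noSingularSurfaceHuggingTowers_of_g14 hP hL hI hZ) hH

/-- **30253 `MaxContactCut.NoForcedTowers` BY NAME** (tree kernel `MaxContactCutSurfaceShadow.noForcedTowers_of_g11`).
[folklore] -/
theorem noForcedTowers_of_g14 (hNF : MaxContactCut.CornerNormalFormAll) (hM : MaxContactCut.MonomialCornerAll)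
    (hK : NoCornerTowers) (hC : MaxContactCut.CurveLawAll) (hSL : MaxContactCut.SurfaceLawAll)
    (hH : MaxContactCut.NoHypersurfaceHuggingTowers) (hP : ShadowPortAll) (hL : DiscreteShadowLawAll)
    (hI : NoDiscreteImperfectShadowTowers) (hZ : NoDenseShadowTowers) :
    MaxContactCut.NoForcedTowers :=
  MaxContactCutSurfaceShadow.noForcedTowers_of_g11 hNF hM hK hC hSL
    (noSingularSurfaceHuggingTowers_of_g14 hP hL hI hZ) hH

/-- 31570 with the corner hypothesis DISCHARGED BY NAME: `NoCornerTowers` is the tree's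
`CornerTowerDynamics.noCornerTowers_tree` (landed 2026-08-30; lens-3 g12 rev 3 / lens-5 g13). [folklore] -/
theorem noHuggingTowers_of_g14' (hM : MaxContactCut.MonomialCornerAll) (hC : MaxContactCut.CurveLawAll)
    (hSL : MaxContactCut.SurfaceLawAll) (hH : MaxContactCut.NoHypersurfaceHuggingTowers) (hP : ShadowPortAll)
    (hL : DiscreteShadowLawAll) (hI : NoDiscreteImperfectShadowTowers) (hZ : NoDenseShadowTowers) :
    MaxContactCut.NoHuggingTowers :=
  noHuggingTowers_of_g14 hM CornerTowerDynamics.noCornerTowers_tree hC hSL hH hP hL hI hZ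

/-- 30253 with the corner hypothesis DISCHARGED BY NAME (`CornerTowerDynamics.noCornerTowers_tree`). [folklore] -/
theorem noForcedTowers_of_g14' (hNF : MaxContactCut.CornerNormalFormAll) (hM : MaxContactCut.MonomialCornerAll)
    (hC : MaxContactCut.CurveLawAll) (hSL : MaxContactCut.SurfaceLawAll) (hH : MaxContactCut.NoHypersurfaceHuggingTowers)
    (hP : ShadowPortAll) (hL : DiscreteShadowLawAll) (hI : NoDiscreteImperfectShadowTowers) (hZ : NoDenseShadowTowers) :
    MaxContactCut.NoForcedTowers :=
  noForcedTowers_of_g14 hNF hM CornerTowerDynamics.noCornerTowers_tree hC hSL hH hP hL hI hZ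

end Summit.ResolutionOfSingularities.ResolutionOfSingularities.Theorems.HugValuationCut

end
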